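import Summits.QuantumFields.BalabanUV.InfraRed.StrongCouplingFluxField
import HarnessLib

/-!
# Venture YMGap, track (a) / A4 kernel port, Stage 2 — the POLYNOMIAL-PROFILE flux field
# `W(y) = e^{κ y₀} · (d′ + p·(P(y₀)·1 + Q(y₀)·y))` on `ℍ`: derivative, frame divergence, trace, size, sphere mean

HONEST FRAMING: venture file of the cell `pub-ymgap` (QuantumFields programme), written for engine-2's kernel port of the
quarter-modulus certificate beyond tilt `κ = 3` (PLAN R78, Stage 2; A4K-KERNEL-PLAN.md «small-divergence witness»).  Pure
[folklore] CALCULUS on the quaternions, kernel-proved; NO certificate, NO number, NO covariance bound is claimed here, and nothing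
about Yang–Mills beyond strong-coupling bookkeeping.  It generalises pub-balaban's leaf (19) `StrongCouplingFluxField` (the field
`e^{κy₀}(e + (αy₀ + β)y)`, i.e. constant `P` and affine `Q`) to ARBITRARY smooth radial profiles `P, Q : ℝ → ℝ`:

    `V(y) = d′ + p·(P(y₀)·1 + Q(y₀)·y)`,   `W(y) = e^{κ y₀}·V(y)`    (`κ p : ℝ`, `d′ : ℍ`, `y₀ = Re y`).

For every `y : ℍ` (derivatives displayed as `HasDerivAt P P₁ y₀`, `HasDerivAt Q Q₁ y₀`):
* smoothness (`contDiff_polyFluxField`) and the derivative of `V` (`hasFDerivAt_profileField`, `fderiv_profileField`);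
* the TRACE `⟪W y, y⟫ = e^{κy₀}(⟪d′, y⟫ + p(P(y₀)y₀ + Q(y₀)|y|²))` (`inner_polyFluxField`); on the unit sphere with the TIED profile
  `Q(t) = t − τ − t·P(t)` this is `e^{κy₀}(⟪d′, y⟫ + p(y₀ − τ))` for EVERY `P` (`inner_polyFluxField_sphere`) — the centred longitudinal
  observable times the tilt density, which is what the Lipschitz–flux lemma F′ (`abs_integral_lipschitz_mul_inner_le`) consumes;
* the FRAME DIVERGENCE `radialDiv W (y) = |y|² e^{κy₀}(κ Re d′ + p·[P₁ + y₀Q₁ + 4Q(y₀) + κ(P(y₀) + y₀Q(y₀))])`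
  (`radialDiv_polyFluxField`; `radialDiv V (y) = |y|² p (P₁ + y₀Q₁ + 4Q(y₀))`, `radialDiv_profileField`), and, for the tied profile,
  the bracket equals engine-2's small-divergence polynomial
  `h(t) = (1 − t²)P₁ + (κ(1 − t²) − 5t)P(t) + κt² + (5 − κτ)t − 4τ` (`bracket_eq_smallDiv`, `radialDiv_polyFluxField_tied`);
* the SIZE `‖W y‖ = e^{κy₀}‖V y‖`, `‖V y‖² = ‖d′‖² + 2pQ(y₀)⟪d′, y⟫ + p²(P(y₀)² + 2P(y₀)Q(y₀)y₀ + Q(y₀)²|y|²)` for `Re d′ = 0`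
  (`norm_polyFluxField`, `norm_profileField_sq`) and the pointwise AM–GM form (`norm_polyFluxField_le`);
* the SPHERE MEAN of the trace on `SU(2)`: `∫ ⟪W x, x⟫ dσ = p ∫ e^{κx₀}(P(x₀)x₀ + Q(x₀)) dσ` for `Re d′ = 0` (reflection symmetry of
  leaf (19), `integral_inner_polyFluxField`); for the tied profile `= p(Z′ − τZ)`, hence `0` when `τZ = Z′` (`integral_inner_polyFluxField_tied`,
  `integral_inner_polyFluxField_eq_zero`);
* the CUBIC instance `P(t) = a₀ + a₁t + a₂t² + a₃t³` (engine-2's least-squares witness degree) with its smoothness and derivative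
  (`cubicProfile`, `tiedProfile`, `contDiff_cubicProfile`, `hasDerivAt_cubicProfile`, `contDiff_tiedProfile`, `hasDerivAt_tiedProfile`).
Evaluation along rays `y = r·x` and the ball moments (`H_expand`/`Q_expand` analogues) are engine-2's `FluxMoments`-type files; the
piece certificates consume the displayed formulas with their own rational constants.  NOT CLAIMED: any covariance bound or threshold.
-/

noncomputable section

open MeasureTheory Filter Finset Real
open scoped NNReal Quaternion Matrix ComplexConjugate BigOperators Matrix.Norms.Frobenius ContDiff Topology
  RealInnerProductSpace
open Matrix Complex
open Literature.MathematicalPhysics.QuantumLattice (su2Quat quatMatrix quatMatrix_mul quatMatrix_su2Quat norm_su2Quat)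
open Literature.MathematicalPhysics.QuantumFieldTheory
open Literature.MathematicalPhysics.QuantumFieldTheory.SUNBakryEmery
open Literature.MathematicalPhysics.QuantumFieldTheory.Balaban1983to89.StrongCouplingVarianceWindow (qI qJ qK)

namespace Summit.Ventures.YMGap.PolyFluxField

open Summit.QuantumFields.BalabanUV.InfraRed.StrongCouplingSphereCalculus
open Summit.QuantumFields.BalabanUV.InfraRed.StrongCouplingFluxBound (radialDiv_smul)
open Summit.QuantumFields.BalabanUV.InfraRed.StrongCouplingFluxField (re_eq_innerSL contDiff_re hasFDerivAt_re
  contDiff_expRe fderiv_expRe frame_inner frame_norm_sq integral_inner_mul_eq_zero)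

/-! ## 1. The fields -/

/-- The profile field `V(y) = d′ + p·(P(y₀)·1 + Q(y₀)·y)`. [folklore] -/
def profileField (d' : ℍ) (p : ℝ) (P Q : ℝ → ℝ) (y : ℍ) : ℍ :=
  d' + p • ((P y.re) • (1 : ℍ) + (Q y.re) • y)

/-- The polynomial-profile flux field `W(y) = e^{κ y₀}·V(y)`. [folklore] -/
def polyFluxField (κ : ℝ) (d' : ℍ) (p : ℝ) (P Q : ℝ → ℝ) (y : ℍ) : ℍ :=
  Real.exp (κ * y.re) • profileField d' p P Q y

/-- `W` as a scalar multiple of `V` (unfolding lemma). [folklore] -/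
theorem polyFluxField_eq (κ : ℝ) (d' : ℍ) (p : ℝ) (P Q : ℝ → ℝ) :
    polyFluxField κ d' p P Q = fun y => Real.exp (κ * y.re) • profileField d' p P Q y := rfl

/-! ## 2. Derivatives -/

/-- Chain rule through `y₀ = Re y`: if `P` has derivative `P₁` at `y₀` then `y ↦ P(y₀)` has derivative `P₁·⟪1, ·⟫`. [folklore] -/
theorem hasFDerivAt_comp_re {P : ℝ → ℝ} {P₁ : ℝ} {y : ℍ} (hP : HasDerivAt P P₁ y.re) :
    HasFDerivAt (fun y : ℍ => P y.re) (P₁ • innerSL ℝ (1 : ℍ)) y :=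
  hP.comp_hasFDerivAt y (hasFDerivAt_re y)

/-- The derivative of `V`: `dV(y)[h] = p·(P₁h₀·1 + Q(y₀)h + Q₁h₀·y)`. [folklore] -/
theorem hasFDerivAt_profileField (d' : ℍ) (p : ℝ) {P Q : ℝ → ℝ} {P₁ Q₁ : ℝ} {y : ℍ} (hP : HasDerivAt P P₁ y.re)
    (hQ : HasDerivAt Q Q₁ y.re) :
    HasFDerivAt (profileField d' p P Q)
      (p • ((P₁ • innerSL ℝ (1 : ℍ)).smulRight (1 : ℍ) +
        ((Q y.re) • ContinuousLinearMap.id ℝ ℍ + (Q₁ • innerSL ℝ (1 : ℍ)).smulRight y))) y := by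
  have h1 : HasFDerivAt (fun y : ℍ => (P y.re) • (1 : ℍ)) ((P₁ • innerSL ℝ (1 : ℍ)).smulRight (1 : ℍ)) y :=
    (hasFDerivAt_comp_re hP).smul_const (1 : ℍ)
  have h2 : HasFDerivAt (fun y : ℍ => (Q y.re) • y)
      ((Q y.re) • ContinuousLinearMap.id ℝ ℍ + (Q₁ • innerSL ℝ (1 : ℍ)).smulRight y) y :=
    (hasFDerivAt_comp_re hQ).smul (hasFDerivAt_id y)
  have h := ((h1.add h2).const_smul p).const_add d'
  exact h

/-- The value of `dV(y)` on a vector `h`. [folklore] -/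
theorem fderiv_profileField (d' : ℍ) (p : ℝ) {P Q : ℝ → ℝ} {P₁ Q₁ : ℝ} {y : ℍ} (hP : HasDerivAt P P₁ y.re)
    (hQ : HasDerivAt Q Q₁ y.re) (h : ℍ) :
    fderiv ℝ (profileField d' p P Q) y h = p • ((P₁ * h.re) • (1 : ℍ) + ((Q y.re) • h + (Q₁ * h.re) • y)) := by
  rw [(hasFDerivAt_profileField d' p hP hQ).fderiv]
  simp only [FunLike.coe_smul, Pi.smul_apply, _root_.add_apply,
    ContinuousLinearMap.smulRight_apply, ContinuousLinearMap.id_apply, smul_eq_mul, ← re_eq_innerSL, mul_comm P₁,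
    mul_comm Q₁]

/-- `V` is smooth when the profiles are. [folklore] -/
theorem contDiff_profileField (d' : ℍ) (p : ℝ) {P Q : ℝ → ℝ} (hP : ContDiff ℝ ∞ P) (hQ : ContDiff ℝ ∞ Q) :
    ContDiff ℝ ∞ (profileField d' p P Q) := by
  have hPr : ContDiff ℝ ∞ fun y : ℍ => P y.re := hP.comp contDiff_re
  have hQr : ContDiff ℝ ∞ fun y : ℍ => Q y.re := hQ.comp contDiff_re
  have h1 : ContDiff ℝ ∞ fun y : ℍ => (P y.re) • (1 : ℍ) := hPr.smul contDiff_const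
  have h2 : ContDiff ℝ ∞ fun y : ℍ => (Q y.re) • y := hQr.smul contDiff_id
  have h3 : ContDiff ℝ ∞ fun y : ℍ => p • ((P y.re) • (1 : ℍ) + (Q y.re) • y) := (h1.add h2).const_smul p
  exact contDiff_const.add h3

/-- `W` is smooth when the profiles are. [folklore] -/
theorem contDiff_polyFluxField (κ : ℝ) (d' : ℍ) (p : ℝ) {P Q : ℝ → ℝ} (hP : ContDiff ℝ ∞ P) (hQ : ContDiff ℝ ∞ Q) :
    ContDiff ℝ ∞ (polyFluxField κ d' p P Q) :=
  (contDiff_expRe κ).smul (contDiff_profileField d' p hP hQ)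

/-! ## 3. The trace (normal component) -/

/-- `⟪1, y⟫ = y₀`. [folklore] -/
theorem inner_one_left (y : ℍ) : ⟪(1 : ℍ), y⟫ = y.re := by
  rw [Quaternion.inner_def, one_mul, Quaternion.re_star]

/-- **The trace of `V`**: `⟪V y, y⟫ = ⟪d′, y⟫ + p(P(y₀)y₀ + Q(y₀)|y|²)`. [folklore] -/
theorem inner_profileField (d' : ℍ) (p : ℝ) (P Q : ℝ → ℝ) (y : ℍ) :
    ⟪profileField d' p P Q y, y⟫ = ⟪d', y⟫ + p * (P y.re * y.re + Q y.re * ‖y‖ ^ 2) := by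
  simp only [profileField, inner_add_left, real_inner_smul_left, inner_one_left, real_inner_self_eq_norm_sq]

/-- **The trace of `W`**: `⟪W y, y⟫ = e^{κy₀}(⟪d′, y⟫ + p(P(y₀)y₀ + Q(y₀)|y|²))`. [folklore] -/
theorem inner_polyFluxField (κ : ℝ) (d' : ℍ) (p : ℝ) (P Q : ℝ → ℝ) (y : ℍ) :
    ⟪polyFluxField κ d' p P Q y, y⟫ = Real.exp (κ * y.re) * (⟪d', y⟫ + p * (P y.re * y.re + Q y.re * ‖y‖ ^ 2)) := by
  rw [polyFluxField, real_inner_smul_left, inner_profileField]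

/-- **The trace of `W` on the unit sphere for the TIED profile `Q(t) = t − τ − t·P(t)`** is
`e^{κy₀}(⟪d′, y⟫ + p(y₀ − τ))` — independent of `P`: the centred longitudinal observable times the tilt density. [folklore] -/
theorem inner_polyFluxField_sphere (κ : ℝ) (d' : ℍ) (p τ : ℝ) {P Q : ℝ → ℝ} (hQ : ∀ t, Q t = t - τ - t * P t) {y : ℍ}
    (hy : ‖y‖ = 1) :
    ⟪polyFluxField κ d' p P Q y, y⟫ = Real.exp (κ * y.re) * (⟪d', y⟫ + p * (y.re - τ)) := by
  rw [inner_polyFluxField, hy, hQ]; ring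

/-! ## 4. The frame divergence -/

/-- **The frame divergence of `V`**: `radialDiv V (y) = |y|²·p·(P₁ + y₀Q₁ + 4Q(y₀))`. [folklore] -/
theorem radialDiv_profileField (d' : ℍ) (p : ℝ) {P Q : ℝ → ℝ} {P₁ Q₁ : ℝ} {y : ℍ} (hP : HasDerivAt P P₁ y.re)
    (hQ : HasDerivAt Q Q₁ y.re) :
    radialDiv (profileField d' p P Q) y = ‖y‖ ^ 2 * (p * (P₁ + y.re * Q₁ + 4 * Q y.re)) := by
  obtain ⟨h1, h2, h3, h8, h9, h10⟩ := frame_inner y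
  obtain ⟨h4, h5, h6, h7⟩ := frame_norm_sq y
  have h1' : ⟪y, y * qI⟫ = 0 := by rw [real_inner_comm]; exact h1
  have h2' : ⟪y, y * qJ⟫ = 0 := by rw [real_inner_comm]; exact h2
  have h3' : ⟪y, y * qK⟫ = 0 := by rw [real_inner_comm]; exact h3
  have hn : ‖y‖ ^ 2 = y.re ^ 2 + y.imI ^ 2 + y.imJ ^ 2 + y.imK ^ 2 := by
    rw [sq, ← Quaternion.normSq_eq_norm_mul_self, Quaternion.normSq_def']
  simp only [radialDiv, fderiv_profileField d' p hP hQ, inner_add_left, real_inner_smul_left, inner_one_left, h1', h2', h3',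
    h4, h5, h6, h7, h8, h9, h10]
  rw [hn]; ring

/-- The real part of `V y`: `Re V(y) = Re d′ + p(P(y₀) + Q(y₀)y₀)`. [folklore] -/
theorem re_profileField (d' : ℍ) (p : ℝ) (P Q : ℝ → ℝ) (y : ℍ) :
    (profileField d' p P Q y).re = d'.re + p * (P y.re + Q y.re * y.re) := by
  simp only [profileField, Quaternion.re_add, Quaternion.re_smul, Quaternion.re_one, smul_eq_mul]; ring

/-- **The frame divergence of `W`**:
`radialDiv W (y) = |y|² e^{κy₀}(κ Re d′ + p·[P₁ + y₀Q₁ + 4Q(y₀) + κ(P(y₀) + y₀Q(y₀))])`. [folklore] -/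
theorem radialDiv_polyFluxField (κ : ℝ) (d' : ℍ) (p : ℝ) {P Q : ℝ → ℝ} (hPd : Differentiable ℝ P) (hQd : Differentiable ℝ Q)
    {P₁ Q₁ : ℝ} {y : ℍ} (hP : HasDerivAt P P₁ y.re) (hQ : HasDerivAt Q Q₁ y.re) :
    radialDiv (polyFluxField κ d' p P Q) y =
      ‖y‖ ^ 2 * Real.exp (κ * y.re) *
        (κ * d'.re + p * (P₁ + y.re * Q₁ + 4 * Q y.re + κ * (P y.re + y.re * Q y.re))) := by
  have hΦ : Differentiable ℝ fun y : ℍ => Real.exp (κ * y.re) := (contDiff_expRe κ).differentiable (by simp)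
  have hV : Differentiable ℝ (profileField d' p P Q) := fun z =>
    (hasFDerivAt_profileField d' p (hPd z.re).hasDerivAt (hQd z.re).hasDerivAt).differentiableAt
  rw [polyFluxField_eq, radialDiv_smul hΦ hV, radialDiv_profileField d' p hP hQ, fderiv_expRe, re_profileField]
  ring

/-- The tied profile `Q(t) = t − τ − t·P(t)` has derivative `1 − P(t) − t·P₁`. [folklore] -/
theorem hasDerivAt_tied {P : ℝ → ℝ} {P₁ : ℝ} (τ : ℝ) {t : ℝ} (hP : HasDerivAt P P₁ t) :
    HasDerivAt (fun t => t - τ - t * P t) (1 - P t - t * P₁) t := by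
  have h := ((hasDerivAt_id' t).sub_const τ).sub ((hasDerivAt_id' t).mul hP)
  have e : (1 : ℝ) - (1 * P t + t * P₁) = 1 - P t - t * P₁ := by ring
  rw [e] at h
  exact h

/-- **The small-divergence polynomial.**  For the tied profile (`Q(t) = t − τ − tP(t)`, `Q₁ = 1 − P(t) − tP₁`) the divergence bracket is
`P₁ + tQ₁ + 4Q(t) + κ(P(t) + tQ(t)) = (1 − t²)P₁ + (κ(1 − t²) − 5t)P(t) + κt² + (5 − κτ)t − 4τ`. [folklore] -/
theorem bracket_eq_smallDiv (κ τ t Pt P₁ : ℝ) :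
    P₁ + t * (1 - Pt - t * P₁) + 4 * (t - τ - t * Pt) + κ * (Pt + t * (t - τ - t * Pt)) =
      (1 - t ^ 2) * P₁ + (κ * (1 - t ^ 2) - 5 * t) * Pt + (κ * t ^ 2 + (5 - κ * τ) * t - 4 * τ) := by
  ring

/-- **The frame divergence of `W` for the tied profile**:
`radialDiv W (y) = |y|² e^{κy₀}(κ Re d′ + p·h(y₀))`, `h(t) = (1 − t²)P₁ + (κ(1 − t²) − 5t)P(t) + κt² + (5 − κτ)t − 4τ`. [folklore] -/
theorem radialDiv_polyFluxField_tied (κ : ℝ) (d' : ℍ) (p τ : ℝ) {P Q : ℝ → ℝ} (hPd : Differentiable ℝ P)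
    (hQ : ∀ t, Q t = t - τ - t * P t) {P₁ : ℝ} {y : ℍ} (hP : HasDerivAt P P₁ y.re) :
    radialDiv (polyFluxField κ d' p P Q) y =
      ‖y‖ ^ 2 * Real.exp (κ * y.re) *
        (κ * d'.re + p * ((1 - y.re ^ 2) * P₁ + (κ * (1 - y.re ^ 2) - 5 * y.re) * P y.re +
          (κ * y.re ^ 2 + (5 - κ * τ) * y.re - 4 * τ))) := by
  have hQf : Q = fun t => t - τ - t * P t := funext hQ
  have hQd : Differentiable ℝ Q := by
    rw [hQf]; exact fun t => (hasDerivAt_tied τ (hPd t).hasDerivAt).differentiableAt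
  have hQ1 : HasDerivAt Q (1 - P y.re - y.re * P₁) y.re := by rw [hQf]; exact hasDerivAt_tied τ hP
  rw [radialDiv_polyFluxField κ d' p hPd hQd hP hQ1, hQ y.re, ← bracket_eq_smallDiv]

/-! ## 5. The size -/

/-- **The size of `W`**: `‖W y‖ = e^{κy₀}‖V y‖`. [folklore] -/
theorem norm_polyFluxField (κ : ℝ) (d' : ℍ) (p : ℝ) (P Q : ℝ → ℝ) (y : ℍ) :
    ‖polyFluxField κ d' p P Q y‖ = Real.exp (κ * y.re) * ‖profileField d' p P Q y‖ := by
  rw [polyFluxField, norm_smul, Real.norm_eq_abs, abs_of_pos (Real.exp_pos _)]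

/-- **The size of `V`** for a transverse `d′` (`Re d′ = 0`):
`‖V y‖² = ‖d′‖² + 2pQ(y₀)⟪d′, y⟫ + p²(P(y₀)² + 2P(y₀)Q(y₀)y₀ + Q(y₀)²|y|²)`. [folklore] -/
theorem norm_profileField_sq (p : ℝ) (P Q : ℝ → ℝ) {d' : ℍ} (hd : d'.re = 0) (y : ℍ) :
    ‖profileField d' p P Q y‖ ^ 2 =
      ‖d'‖ ^ 2 + 2 * p * Q y.re * ⟪d', y⟫ +
        p ^ 2 * (P y.re ^ 2 + 2 * P y.re * Q y.re * y.re + Q y.re ^ 2 * ‖y‖ ^ 2) := by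
  have h1 : ⟪d', (1 : ℍ)⟫ = 0 := by rw [real_inner_comm, inner_one_left, hd]
  have h11 : ⟪(1 : ℍ), (1 : ℍ)⟫ = 1 := by rw [inner_one_left, Quaternion.re_one]
  rw [profileField, ← real_inner_self_eq_norm_sq, ← real_inner_self_eq_norm_sq d', ← real_inner_self_eq_norm_sq y]
  simp only [inner_add_left, inner_add_right, real_inner_smul_left, real_inner_smul_right, h1, h11, inner_one_left, hd,
    real_inner_comm y d', real_inner_comm (1 : ℍ) y, mul_zero, zero_add]
  ring

/-- **Pointwise AM–GM for the size of `W`**: for every `λ > 0`, `‖W y‖ ≤ (λ e^{κy₀} + e^{κy₀}‖V y‖²/λ)/2`. [folklore] -/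
theorem norm_polyFluxField_le (κ : ℝ) (d' : ℍ) (p : ℝ) (P Q : ℝ → ℝ) (y : ℍ) {l : ℝ} (hl : 0 < l) :
    ‖polyFluxField κ d' p P Q y‖ ≤
      (l * Real.exp (κ * y.re) + Real.exp (κ * y.re) * ‖profileField d' p P Q y‖ ^ 2 / l) / 2 := by
  rw [norm_polyFluxField]
  have hE := Real.exp_pos (κ * y.re)
  set E := Real.exp (κ * y.re)
  set n := ‖profileField d' p P Q y‖
  have hn : 0 ≤ n := norm_nonneg _
  rw [le_div_iff₀ two_pos, ← sub_nonneg]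
  have : l * E + E * n ^ 2 / l - E * n * 2 = E * (l - n) ^ 2 / l := by field_simp; ring
  rw [this]; positivity

/-! ## 6. The sphere mean of the trace on `SU(2)` -/

/-- Continuity of `su2Quat`. [folklore] -/
private theorem continuous_su2QuatPF : Continuous (su2Quat : Matrix.specialUnitaryGroup (Fin 2) ℂ → ℍ) := by
  have h : Continuous fun g : Matrix.specialUnitaryGroup (Fin 2) ℂ => quatOfMat (g : Matrix (Fin 2) (Fin 2) ℂ) :=
    (LinearMap.continuous_of_finiteDimensional quatOfMat).comp continuous_subtype_val
  simpa only [quatOfMat_coe] using h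

/-- **Mean of the trace of `W` on the sphere** (`|x| = 1`), transverse part killed by the reflection symmetry of leaf (19):
for `Re d′ = 0` and continuous profiles, `∫ ⟪W x, x⟫ dσ = p ∫ e^{κx₀}(P(x₀)x₀ + Q(x₀)) dσ`. [folklore] -/
theorem integral_inner_polyFluxField (κ : ℝ) {d' : ℍ} (hd : d'.re = 0) (p : ℝ) {P Q : ℝ → ℝ} (hPc : Continuous P)
    (hQc : Continuous Q) :
    ∫ g : Matrix.specialUnitaryGroup (Fin 2) ℂ, ⟪polyFluxField κ d' p P Q (su2Quat g), su2Quat g⟫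
      ∂haarProbability (Matrix.specialUnitaryGroup (Fin 2) ℂ) =
      p * ∫ g : Matrix.specialUnitaryGroup (Fin 2) ℂ,
        Real.exp (κ * (su2Quat g).re) * (P (su2Quat g).re * (su2Quat g).re + Q (su2Quat g).re)
          ∂haarProbability (Matrix.specialUnitaryGroup (Fin 2) ℂ) := by
  have hq := continuous_su2QuatPF
  have hre : Continuous fun g : Matrix.specialUnitaryGroup (Fin 2) ℂ => (su2Quat g).re := Quaternion.continuous_re.comp hq
  have hE : Continuous fun g : Matrix.specialUnitaryGroup (Fin 2) ℂ => Real.exp (κ * (su2Quat g).re) :=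
    (continuous_const.mul hre).rexp
  have hpt : ∀ g : Matrix.specialUnitaryGroup (Fin 2) ℂ,
      ⟪polyFluxField κ d' p P Q (su2Quat g), su2Quat g⟫ =
        ⟪d', su2Quat g⟫ * Real.exp (κ * (su2Quat g).re) +
          p * (Real.exp (κ * (su2Quat g).re) * (P (su2Quat g).re * (su2Quat g).re + Q (su2Quat g).re)) := by
    intro g
    rw [inner_polyFluxField, norm_su2Quat]
    ring
  simp_rw [hpt]
  have i1 : Integrable (fun g : Matrix.specialUnitaryGroup (Fin 2) ℂ => ⟪d', su2Quat g⟫ * Real.exp (κ * (su2Quat g).re))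
      (haarProbability (Matrix.specialUnitaryGroup (Fin 2) ℂ)) :=
    integrable_of_continuous_SUN ((continuous_const.inner hq).mul hE) _
  have i2 : Integrable (fun g : Matrix.specialUnitaryGroup (Fin 2) ℂ =>
      p * (Real.exp (κ * (su2Quat g).re) * (P (su2Quat g).re * (su2Quat g).re + Q (su2Quat g).re)))
      (haarProbability (Matrix.specialUnitaryGroup (Fin 2) ℂ)) :=
    integrable_of_continuous_SUN (continuous_const.mul (hE.mul (((hPc.comp hre).mul hre).add (hQc.comp hre)))) _
  rw [integral_add i1 i2, integral_const_mul, integral_inner_mul_eq_zero hd (fun t => Real.exp (κ * t)), zero_add]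

/-- **Mean of the trace for the tied profile**: `∫ ⟪W x, x⟫ dσ = p(Z′ − τZ)` with `Z = ∫ e^{κx₀} dσ`, `Z′ = ∫ x₀e^{κx₀} dσ` — for
EVERY (continuous) `P`. [folklore] -/
theorem integral_inner_polyFluxField_tied (κ : ℝ) {d' : ℍ} (hd : d'.re = 0) (p τ : ℝ) {P Q : ℝ → ℝ} (hPc : Continuous P)
    (hQ : ∀ t, Q t = t - τ - t * P t) :
    ∫ g : Matrix.specialUnitaryGroup (Fin 2) ℂ, ⟪polyFluxField κ d' p P Q (su2Quat g), su2Quat g⟫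
      ∂haarProbability (Matrix.specialUnitaryGroup (Fin 2) ℂ) =
      p * (∫ g : Matrix.specialUnitaryGroup (Fin 2) ℂ, (su2Quat g).re * Real.exp (κ * (su2Quat g).re)
          ∂haarProbability (Matrix.specialUnitaryGroup (Fin 2) ℂ) -
        τ * ∫ g : Matrix.specialUnitaryGroup (Fin 2) ℂ, Real.exp (κ * (su2Quat g).re)
          ∂haarProbability (Matrix.specialUnitaryGroup (Fin 2) ℂ)) := by
  have hQf : Q = fun t => t - τ - t * P t := funext hQ
  have hQc : Continuous Q := by rw [hQf]; exact (continuous_id.sub continuous_const).sub (continuous_id.mul hPc)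
  rw [integral_inner_polyFluxField κ hd p hPc hQc]
  have hq := continuous_su2QuatPF
  have hre : Continuous fun g : Matrix.specialUnitaryGroup (Fin 2) ℂ => (su2Quat g).re := Quaternion.continuous_re.comp hq
  have hE : Continuous fun g : Matrix.specialUnitaryGroup (Fin 2) ℂ => Real.exp (κ * (su2Quat g).re) :=
    (continuous_const.mul hre).rexp
  have hpt : ∀ g : Matrix.specialUnitaryGroup (Fin 2) ℂ,
      Real.exp (κ * (su2Quat g).re) * (P (su2Quat g).re * (su2Quat g).re + Q (su2Quat g).re) =
        (su2Quat g).re * Real.exp (κ * (su2Quat g).re) - τ * Real.exp (κ * (su2Quat g).re) := by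
    intro g; rw [hQ]; ring
  simp_rw [hpt]
  have i1 : Integrable (fun g : Matrix.specialUnitaryGroup (Fin 2) ℂ => (su2Quat g).re * Real.exp (κ * (su2Quat g).re))
      (haarProbability (Matrix.specialUnitaryGroup (Fin 2) ℂ)) := integrable_of_continuous_SUN (hre.mul hE) _
  have i2 : Integrable (fun g : Matrix.specialUnitaryGroup (Fin 2) ℂ => τ * Real.exp (κ * (su2Quat g).re))
      (haarProbability (Matrix.specialUnitaryGroup (Fin 2) ℂ)) := integrable_of_continuous_SUN (continuous_const.mul hE) _
  rw [integral_sub i1 i2, integral_const_mul]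

/-- **Vanishing sphere mean** (the hypothesis `h0` of the Lipschitz–flux lemma F′): for the tied profile and `τ·Z = Z′`,
`∫ ⟪W x, x⟫ dσ = 0`. [folklore] -/
theorem integral_inner_polyFluxField_eq_zero (κ : ℝ) {d' : ℍ} (hd : d'.re = 0) (p : ℝ) {τ : ℝ} {P Q : ℝ → ℝ}
    (hPc : Continuous P) (hQ : ∀ t, Q t = t - τ - t * P t)
    (hτ : τ * ∫ g : Matrix.specialUnitaryGroup (Fin 2) ℂ, Real.exp (κ * (su2Quat g).re)
        ∂haarProbability (Matrix.specialUnitaryGroup (Fin 2) ℂ) =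
      ∫ g : Matrix.specialUnitaryGroup (Fin 2) ℂ, (su2Quat g).re * Real.exp (κ * (su2Quat g).re)
        ∂haarProbability (Matrix.specialUnitaryGroup (Fin 2) ℂ)) :
    ∫ g : Matrix.specialUnitaryGroup (Fin 2) ℂ, ⟪polyFluxField κ d' p P Q (su2Quat g), su2Quat g⟫
      ∂haarProbability (Matrix.specialUnitaryGroup (Fin 2) ℂ) = 0 := by
  rw [integral_inner_polyFluxField_tied κ hd p τ hPc hQ, ← hτ, sub_self, mul_zero]

/-! ## 7. The cubic instance (engine-2's witness degree) -/

/-- The cubic profile `P(t) = a₀ + a₁t + a₂t² + a₃t³`. [folklore] -/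
def cubicProfile (a₀ a₁ a₂ a₃ : ℝ) (t : ℝ) : ℝ := a₀ + a₁ * t + a₂ * t ^ 2 + a₃ * t ^ 3

/-- The tied quartic profile `Q(t) = t − τ − t·P(t)`. [folklore] -/
def tiedProfile (τ a₀ a₁ a₂ a₃ : ℝ) (t : ℝ) : ℝ := t - τ - t * cubicProfile a₀ a₁ a₂ a₃ t

/-- The tied profile, unfolded pointwise. [folklore] -/
theorem tiedProfile_eq (τ a₀ a₁ a₂ a₃ t : ℝ) :
    tiedProfile τ a₀ a₁ a₂ a₃ t = t - τ - t * cubicProfile a₀ a₁ a₂ a₃ t := rfl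

/-- The cubic profile is smooth. [folklore] -/
theorem contDiff_cubicProfile (a₀ a₁ a₂ a₃ : ℝ) : ContDiff ℝ ∞ (cubicProfile a₀ a₁ a₂ a₃) := by
  unfold cubicProfile
  exact ((contDiff_const.add (contDiff_const.mul contDiff_id)).add (contDiff_const.mul (contDiff_id.pow 2))).add
    (contDiff_const.mul (contDiff_id.pow 3))

/-- The tied profile is smooth. [folklore] -/
theorem contDiff_tiedProfile (τ a₀ a₁ a₂ a₃ : ℝ) : ContDiff ℝ ∞ (tiedProfile τ a₀ a₁ a₂ a₃) := by
  unfold tiedProfile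
  exact (contDiff_id.sub contDiff_const).sub (contDiff_id.mul (contDiff_cubicProfile a₀ a₁ a₂ a₃))

/-- The derivative of the cubic profile: `P′(t) = a₁ + 2a₂t + 3a₃t²`. [folklore] -/
theorem hasDerivAt_cubicProfile (a₀ a₁ a₂ a₃ t : ℝ) :
    HasDerivAt (cubicProfile a₀ a₁ a₂ a₃) (a₁ + 2 * a₂ * t + 3 * a₃ * t ^ 2) t := by
  unfold cubicProfile
  have h := (((hasDerivAt_const t a₀).add ((hasDerivAt_id' t).const_mul a₁)).add
    (((hasDerivAt_id' t).pow 2).const_mul a₂)).add (((hasDerivAt_id' t).pow 3).const_mul a₃)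
  refine h.congr_deriv ?_
  simp only [Nat.cast_ofNat, Nat.add_one_sub_one, pow_one, mul_one, zero_add]
  ring

/-- The derivative of the tied profile: `Q′(t) = 1 − P(t) − t·P′(t)`. [folklore] -/
theorem hasDerivAt_tiedProfile (τ a₀ a₁ a₂ a₃ t : ℝ) :
    HasDerivAt (tiedProfile τ a₀ a₁ a₂ a₃)
      (1 - cubicProfile a₀ a₁ a₂ a₃ t - t * (a₁ + 2 * a₂ * t + 3 * a₃ * t ^ 2)) t :=
  hasDerivAt_tied τ (hasDerivAt_cubicProfile a₀ a₁ a₂ a₃ t)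

/-- **The frame divergence of the cubic-witness field** (the formula the piece certificates consume): with `P = cubicProfile a`,
`Q = tiedProfile τ a`, `radialDiv W (y) = |y|² e^{κy₀}(κ Re d′ + p·h(y₀))`,
`h(t) = (1 − t²)(a₁ + 2a₂t + 3a₃t²) + (κ(1 − t²) − 5t)(a₀ + a₁t + a₂t² + a₃t³) + κt² + (5 − κτ)t − 4τ`. [folklore] -/
theorem radialDiv_cubicFluxField (κ : ℝ) (d' : ℍ) (p τ a₀ a₁ a₂ a₃ : ℝ) (y : ℍ) :
    radialDiv (polyFluxField κ d' p (cubicProfile a₀ a₁ a₂ a₃) (tiedProfile τ a₀ a₁ a₂ a₃)) y =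
      ‖y‖ ^ 2 * Real.exp (κ * y.re) *
        (κ * d'.re + p * ((1 - y.re ^ 2) * (a₁ + 2 * a₂ * y.re + 3 * a₃ * y.re ^ 2) +
          (κ * (1 - y.re ^ 2) - 5 * y.re) * (a₀ + a₁ * y.re + a₂ * y.re ^ 2 + a₃ * y.re ^ 3) +
          (κ * y.re ^ 2 + (5 - κ * τ) * y.re - 4 * τ))) := by
  have hPd : Differentiable ℝ (cubicProfile a₀ a₁ a₂ a₃) := (contDiff_cubicProfile a₀ a₁ a₂ a₃).differentiable (by simp)
  rw [radialDiv_polyFluxField_tied κ d' p τ hPd (tiedProfile_eq τ a₀ a₁ a₂ a₃) (hasDerivAt_cubicProfile a₀ a₁ a₂ a₃ y.re)]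
  rfl

/-- **The trace of the cubic-witness field on `SU(2)`**: `⟪W x, x⟫ = e^{κx₀}(⟪d′, x⟫ + p(x₀ − τ))`. [folklore] -/
theorem inner_cubicFluxField_su2 (κ : ℝ) (d' : ℍ) (p τ a₀ a₁ a₂ a₃ : ℝ) (g : Matrix.specialUnitaryGroup (Fin 2) ℂ) :
    ⟪polyFluxField κ d' p (cubicProfile a₀ a₁ a₂ a₃) (tiedProfile τ a₀ a₁ a₂ a₃) (su2Quat g), su2Quat g⟫ =
      Real.exp (κ * (su2Quat g).re) * (⟪d', su2Quat g⟫ + p * ((su2Quat g).re - τ)) :=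
  inner_polyFluxField_sphere κ d' p τ (tiedProfile_eq τ a₀ a₁ a₂ a₃) (norm_su2Quat g)

/-- **The cubic-witness field is admissible for lemma F′**: smooth, and of vanishing sphere-mean trace when `Re d′ = 0` and
`τZ = Z′`. [folklore] -/
theorem cubicFluxField_admissible (κ : ℝ) {d' : ℍ} (hd : d'.re = 0) (p : ℝ) {τ : ℝ} (a₀ a₁ a₂ a₃ : ℝ)
    (hτ : τ * ∫ g : Matrix.specialUnitaryGroup (Fin 2) ℂ, Real.exp (κ * (su2Quat g).re)
        ∂haarProbability (Matrix.specialUnitaryGroup (Fin 2) ℂ) =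
      ∫ g : Matrix.specialUnitaryGroup (Fin 2) ℂ, (su2Quat g).re * Real.exp (κ * (su2Quat g).re)
        ∂haarProbability (Matrix.specialUnitaryGroup (Fin 2) ℂ)) :
    ContDiff ℝ ∞ (polyFluxField κ d' p (cubicProfile a₀ a₁ a₂ a₃) (tiedProfile τ a₀ a₁ a₂ a₃)) ∧
      ∫ g : Matrix.specialUnitaryGroup (Fin 2) ℂ,
          ⟪polyFluxField κ d' p (cubicProfile a₀ a₁ a₂ a₃) (tiedProfile τ a₀ a₁ a₂ a₃) (su2Quat g), su2Quat g⟫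
        ∂haarProbability (Matrix.specialUnitaryGroup (Fin 2) ℂ) = 0 :=
  ⟨contDiff_polyFluxField κ d' p (contDiff_cubicProfile a₀ a₁ a₂ a₃) (contDiff_tiedProfile τ a₀ a₁ a₂ a₃),
    integral_inner_polyFluxField_eq_zero κ hd p (contDiff_cubicProfile a₀ a₁ a₂ a₃).continuous
      (tiedProfile_eq τ a₀ a₁ a₂ a₃) hτ⟩

end Summit.Ventures.YMGap.PolyFluxField
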